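import Mathlib
import HarnessLib
import Summits.HubbardSuperconductivity.HubbardSuperconductivity.Theorems.KLProgrammeKLRegimeTwoVolumeTowerStepCovData

/-!
# K3 VL child `KLRegimeVolumeLimitV17F2` (stmt-HubbardSuperconductivity-20440), blueprint v5 M3b-j (i) IN THE TOWER'S VOCABULARY, WINDOW-FREE PART:
# the replica-Gram constant and the entry sup of `klStepCov V M β μ K k` at ANY admissible frame `K`, every `k ≥ 1`

Cell `gate-hubbard-kl`, seat p3 (g13).  Of the four data in `ScaleCovData (klStepCov V M β μ K k) Λ κ αW sW` (`…TwoVolumeSpineDataDefs`), the Λ-scaled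
ROWS / COLUMNS need spatial decay of the slice kernel, hence third differences of the frame's dispersion, hence the deep window `4^{n+2}·U ≤ 4^{2k+d}` of
p3 g12's `scaleCovData_klStepCov_klEng_flow_deep_vol` («W2-HALF»).  The GRAM constant and the ENTRY sup do not: they are sup bounds of the sampled symbol
(k3c2-p3's `gram_entry_klSliceCov_bgmFat_klEng`, keyed by `FrameOK` alone).  This file states that window-free part BY NAME for the tower's step covariance:

* **`gram_entry_klStepCov_klEng`** — `∃ Cκ > 0` (absolute): under `P.WF`, `R.WF2`, `0 < c ≤ klEngC₃3 P R`, `μ ∈ klWindowC`, `0 < U ≤ klEngU₀4 P R c`,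
  `klBetaMin ≤ β ≤ e^{c/U²}`, for EVERY frame `K` with `FrameOK R U (nScales β) μ K` (the coarse flow frame, the fine volume's own frame, any telescope
  frame), every lattice `V` with `klEngL₃ β U ≤ V`, `klEngM₃ β U V ≤ M`, and every `1 ≤ k ≤ n_β + 1`:
  `‖klStepCov V M β μ K k Y Y′‖ ≤ Cκ·(Λ_k/Λ_{k+2})·klE0·8^{−k}` and `IsGramBoundedR (klStepCov V M β μ K k) √(Cκ·(Λ_k/Λ_{k+2})·klE0·8^{−k})`
  — the `gram` / `entry` / `κ_pos` / `sW_nonneg` fields of `ScaleCovData` with the SAME `κ_k` as the flow-deep door, for all `k ≥ 1` (shallow half included);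
* `klScale_div_klScale_add_two` — the shift factor is the absolute `Λ_k/Λ_{k+2} = 16`.

So at the top frame only the weighted rows/columns (and the sectional row, and the re-analysis rows of the transfer) of the SHALLOW steps remain for the
frame telescope; Gram, entry, slot shift and block covariance are frame-generic.  Everything is proved; no definitions; nothing asserts any stub, K3, VL or
superconductivity. [cite: BenfattoGiulianiMastropietro2006, §2.7 (2.66)–(2.67), §2.8 (2.80)]
-/

noncomputable section

namespace Summit.HubbardSuperconductivity.HubbardSuperconductivity.Theorems.TorusFourierL2

set_option linter.dupNamespace false -- summit = problem name (single-conjunct summit), D-0017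

open Set Finset Literature.MathematicalPhysics.QuantumLattice Literature.MathematicalPhysics.QuantumLattice.BandSectorCounting
open Literature.MathematicalPhysics.QuantumLattice.FermiRG Literature.Probability.LatticeModels Literature.Analysis.SpecialFunctions
open Summit.HubbardSuperconductivity.HubbardSuperconductivity.Theorems.DispersionFlow
open Summit.HubbardSuperconductivity.HubbardSuperconductivity.Theorems.KLRegimeSplit
open Summit.HubbardSuperconductivity.HubbardSuperconductivity.Theorems.KLProgrammeLegKernels
open Summit.HubbardSuperconductivity.HubbardSuperconductivity.Theorems.PerturbedFermiCurve
open Summit.HubbardSuperconductivity.HubbardSuperconductivity.Theorems.KLRegimeWick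
open Summit.HubbardSuperconductivity.HubbardSuperconductivity.Theorems.EngineV8
open Summit.HubbardSuperconductivity.HubbardSuperconductivity.Theorems.TwoVolumeSource
open Summit.HubbardSuperconductivity.HubbardSuperconductivity.Theorems.TwoVolumeDefect
open scoped Real Nat

open Classical

/-- **The scale shift factor of the step covariance is absolute**: `Λ_k / Λ_{k+2} = 16`. [folklore] -/
theorem klScale_div_klScale_add_two (k : ℕ) : klScale klE0 k / klScale klE0 (k + 2) = 16 := by
  have he : (0 : ℝ) < klE0 := by norm_num [klE0]
  rw [klScale, klScale, pow_add]
  field_simp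
  norm_num

set_option maxHeartbeats 400000 in -- long binder list
/-- **M3b-j (i), window-free part, in the tower's vocabulary**: one absolute `Cκ > 0` such that, under the engine binders (`P.WF`, `R.WF2`,
`0 < c ≤ klEngC₃3 P R`, `μ ∈ klWindowC`, `0 < U ≤ klEngU₀4 P R c`, `klBetaMin ≤ β ≤ e^{c/U²}`), for EVERY frame `K` with `FrameOK R U (nScales β) μ K`,
every lattice `V` (`klEngL₃ β U ≤ V`, `klEngM₃ β U V ≤ M`) and every `1 ≤ k ≤ n_β + 1`: the entries of `klStepCov V M β μ K k` are
`≤ Cκ·(Λ_k/Λ_{k+2})·klE0·8^{−k}` and `klStepCov V M β μ K k` is replica-Gram bounded by the square root of that number — the `entry`/`gram` fields of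
`ScaleCovData` with the flow-deep door's `κ_k`, with NO deep window (k3c2-p3 `gram_entry_klSliceCov_bgmFat_klEng` at `n′ := k+2`, re-keyed by
`klStepCov_eq_klSliceCov`). [cite: BenfattoGiulianiMastropietro2006, §2.7 (2.66)–(2.67), §2.8 (2.80)] -/
theorem gram_entry_klStepCov_klEng :
    ∃ Cκ : ℝ, 0 < Cκ ∧ ∀ (P : SplitConsts) (R : RenConsts) (c : ℝ), P.WF → R.WF2 → 0 < c → c ≤ EngineV8.klEngC₃3 P R →
      ∀ μ ∈ klWindowC, ∀ U : ℝ, 0 < U → U ≤ EngineV8.klEngU₀4 P R c → ∀ β : ℝ, klBetaMin ≤ β → β ≤ Real.exp (c / U ^ 2) →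
      ∀ K : TrigPolyC4v, FrameOK R U (nScales β) μ K → ∀ (V M : ℕ) [NeZero V] [NeZero M],
      EngineV8.klEngL₃ β U ≤ V → EngineV8.klEngM₃ β U V ≤ M → ∀ k : ℕ, 1 ≤ k → k ≤ nScales β + 1 →
        (∀ Y Y' : SpaceTimeIdx V M × SectorLeg (sectorCount k),
          ‖klStepCov V M β μ K k Y Y'‖ ≤ Cκ * (klScale klE0 k / klScale klE0 (k + 2)) * (klE0 * ((8 : ℝ) ^ k)⁻¹)) ∧
        IsGramBoundedR (klStepCov V M β μ K k) (Real.sqrt (Cκ * (klScale klE0 k / klScale klE0 (k + 2)) * (klE0 * ((8 : ℝ) ^ k)⁻¹))) := by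
  obtain ⟨Cκ, hCκ, h⟩ := gram_entry_klSliceCov_bgmFat_klEng
  refine ⟨Cκ, hCκ, ?_⟩
  intro P R c hP hR2 hc hc3 μ hμ U hU hU4 β hβmin hβc K hK V M _ _ hV3 hVM3 k hk hkN
  rw [klStepCov_eq_klSliceCov]
  exact h P R c hP hR2 hc hc3 μ hμ U hU hU4 β hβmin hβc K hK V M hV3 hVM3 k hk hkN (k + 2) (by omega)

set_option maxHeartbeats 400000 in -- long binder list
/-- **The same with the shift factor evaluated** (`Λ_k/Λ_{k+2} = 16`): entries `≤ 16·Cκ·klE0·8^{−k}`, Gram constant `√(16·Cκ·klE0·8^{−k})`.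
[cite: BenfattoGiulianiMastropietro2006, §2.8 (2.80)] -/
theorem gram_entry_klStepCov_klEng' :
    ∃ Cκ : ℝ, 0 < Cκ ∧ ∀ (P : SplitConsts) (R : RenConsts) (c : ℝ), P.WF → R.WF2 → 0 < c → c ≤ EngineV8.klEngC₃3 P R →
      ∀ μ ∈ klWindowC, ∀ U : ℝ, 0 < U → U ≤ EngineV8.klEngU₀4 P R c → ∀ β : ℝ, klBetaMin ≤ β → β ≤ Real.exp (c / U ^ 2) →
      ∀ K : TrigPolyC4v, FrameOK R U (nScales β) μ K → ∀ (V M : ℕ) [NeZero V] [NeZero M],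
      EngineV8.klEngL₃ β U ≤ V → EngineV8.klEngM₃ β U V ≤ M → ∀ k : ℕ, 1 ≤ k → k ≤ nScales β + 1 →
        (∀ Y Y' : SpaceTimeIdx V M × SectorLeg (sectorCount k), ‖klStepCov V M β μ K k Y Y'‖ ≤ 16 * Cκ * (klE0 * ((8 : ℝ) ^ k)⁻¹)) ∧
        IsGramBoundedR (klStepCov V M β μ K k) (Real.sqrt (16 * Cκ * (klE0 * ((8 : ℝ) ^ k)⁻¹))) := by
  obtain ⟨Cκ, hCκ, h⟩ := gram_entry_klStepCov_klEng
  refine ⟨Cκ, hCκ, ?_⟩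
  intro P R c hP hR2 hc hc3 μ hμ U hU hU4 β hβmin hβc K hK V M _ _ hV3 hVM3 k hk hkN
  have h' := h P R c hP hR2 hc hc3 μ hμ U hU hU4 β hβmin hβc K hK V M hV3 hVM3 k hk hkN
  rw [klScale_div_klScale_add_two, show Cκ * 16 * (klE0 * ((8 : ℝ) ^ k)⁻¹) = 16 * Cκ * (klE0 * ((8 : ℝ) ^ k)⁻¹) by ring] at h'
  exact h'

end Summit.HubbardSuperconductivity.HubbardSuperconductivity.Theorems.TorusFourierL2

end
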